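import Summits.CriticalPhenomena.SAWScalingLimit.Theses.SAWBrickWallHomotopy
import Summits.CriticalPhenomena.SAWScalingLimit.Theses.SAWConfRestriction
import Summits.CriticalPhenomena.SAWScalingLimit.Theses.SAWDevelopingMap
import Summits.CriticalPhenomena.SAWScalingLimit.Theorems.SAWBrickWallHomotopyModulusUniversalityAffineTransport
import Summits.CriticalPhenomena.SAWScalingLimit.Theorems.SAWBrickWallHomotopyModulusUniversalityImpliesZ2Tight
import Summits.CriticalPhenomena.SAWScalingLimit.Theorems.SAWBrickWallHomotopyModulusUniversalityOfEventualTight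
import Summits.CriticalPhenomena.SAWScalingLimit.Theorems.SAWBrickWallHomotopyModulusUniversalityLipOfCollarSplit
import Summits.CriticalPhenomena.SAWScalingLimit.Theorems.SAWBrickWallHomotopyModulusUniversalityDisputedCollar
import Summits.CriticalPhenomena.SAWScalingLimit.Theorems.SAWBrickWallHomotopyModulusUniversalityBoundaryAvoidanceTransport
import Summits.CriticalPhenomena.SAWScalingLimit.Theorems.SAWBrickWallHomotopyModulusUniversalityBoundaryAvoidanceHexOfHexConjecture
import Summits.CriticalPhenomena.SAWScalingLimit.Theorems.SAWCompassLatticeSurfaceUniversalityTightToll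
import Summits.CriticalPhenomena.SAWScalingLimit.Theorems.SAWMassiveIsingTiltHexEndpointApproxExists
import Summits.CriticalPhenomena.SAWScalingLimit.Theorems.SAWBrickWallHomotopyModulusUniversalityBWRobustOfLipMerging
import Summits.CriticalPhenomena.SAWScalingLimit.Theorems.SAWBrickWallHomotopyModulusUniversalityBoundaryAvoidanceBWOfBWRobust
import Literature.Probability.RandomPlanarGeometry.SAWBrickWallHex
import Literature.Probability.RandomPlanarGeometry.SLEConvergenceCriterion
import Literature.Probability.RandomPlanarGeometry.SLEUniquenessInLaw
import Literature.Probability.RandomPlanarGeometry.LatticeSimilarityCovariance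
import Literature.Probability.RandomPlanarGeometry.ConformalRestrictionProofs
import Literature.Probability.Percolation.QuadCrossingCrossedEventInterior

/-!
# Skeleton of the line `birth` / `registered` for the crux `SAWBrickWallHomotopy.ModulusUniversality`

RESHAPE 7 (lead c3 prover-line-stmt-CriticalPhenomena-5790-c3-0, 2026-08-17 — this file).  Registered OPEN stubs:
A = `stub_brickWallComparison` (= route crux `BrickWallFlow`, stmt-5791, at `t = 0`), H = `stub_hexConjecture`
(= route crux `HexConjecture`, stmt-0808, BY NAME) and ONE new conjecture-grade, convention-free leaf
R = `stub_bwRobust` : `HexConjecture →` the critical STRAIGHT brick-wall law of `E` (the honeycomb walk read in `ℤ²`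
conventions: largest `ℤ²` mesh component of `E`, closed-segment edge rule, brick-wall bonds, weight `x_c(ℍ)^{#steps}`),
along EVERY `ℤ²` endpoint approximation that makes it eventually a probability law, straightened by `B⁻¹ = diag(1/2, √3/2)`,
`ConvergesInLawToSLE (8/3)` in `B⁻¹E` — Duminil-Copin–Smirnov Conjecture 1 for the `ℤ²`-convention discretisation of the
honeycomb lattice, GIVEN Conjecture 1 for the canonical one (same shape as the HexTransfer research stub
`YbRelay.stub_hexFaceRobust`, crux stmt-14221: "DCS Conj. 1 ⇒ DCS Conj. 1 for another admissible discretisation").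
Composition `ModulusUniversality_of : A → H → R → crux`: SLE₈⸝₃ uniqueness in law (tree theorem
`IsSLECurve.map_eq_holds`) merges the two convergent families (`tendsto_sub_of_convergesInLawToSLE`), the rest is the
reshape-2 bookkeeping (`Φ = Ψ ∘ B`, `MarkedDomain.map_map`, `CurveClass.map_homeomorph_trans`).
WHY (honest re-audit): given H — which the route owes anyway (rank-2 crux, consumed by the Assembly) — the reshape-6 transport
leaves {Z = EventualTight (1881), BA_bw, M2b} are a SUFFICIENT lattice programme for R (landed chain p154967 … p167392 gives
L = `JitteredLipMerging`; L + H ⇒ R by Portmanteau on bounded-Lipschitz functions), R ⇒ BA_bw (Portmanteau + Rohde–Schramm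
boundary non-hitting, as p167392), and Z is not needed at all (R is a genuine limit theorem for the brick-wall side).  So the
crux's residue modulo the route's own items {5791, 0808} is EXACTLY R; the former leaves stay in the tree as the lattice-level
attack on R (their `__Registered` abbreviations and derived glue are kept below, no `sorry`).

(crux item stmt-CriticalPhenomena-5790, rank 3 of `route-CriticalPhenomena-SAWBrickWallHomotopy`, sub-problem
`SAWScalingLimit`; registrar planner-skel-stmt-CriticalPhenomena-5790-0 (BC3 birth, 2026-08-17); lead
prover-line-stmt-CriticalPhenomena-5790-0: reshapes 1–2; lead c1 prover-line-stmt-CriticalPhenomena-5790-c1-0: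
RESHAPE 3 and RESHAPE 4; lead c2 prover-line-stmt-CriticalPhenomena-5790-c2-0: RESHAPE 5 (this file, 2026-08-17); tree path
`Summits/CriticalPhenomena/SAWScalingLimit/Cruxes/ModulusUniversality/Lines/birth.lean`.)

Crux (FIXED, by name): `ModulusUniversality` — there are `r₁, r₂ > 0` such that for the diagonal homeomorphism
`Φ(x+iy) = r₁x + i r₂y`, every Dobrushin domain `D` and every `ℤ²` endpoint approximation of `D`, some hexagonal
endpoint approximation of `Φ⁻¹(D)` makes `∫ f(curve) dP^{ℤ²}_{(D,δ)} − ∫ f(Φ∘curve) dP^{Hex}_{(Φ⁻¹D,δ)} → 0`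
(`δ → 0⁺`) for every bounded continuous `f` on `CurveClass ℂ`.

## The line: HONEYCOMB = BRICK WALL ⊂ ℤ² — cut the crux at the graph isomorphism

RESHAPE 3 (what changed and why).  Reshape 2 registered the stubs A (`stub_brickWallComparison` = the route
crux `BrickWallFlow`, stmt-5791, at `t = 0`), H (`stub_hexTight` = `SAWDevelopingMap.HexTight`, stmt-5423, by
name) and L (`stub_jitteredLipMerging`).  H entered only to upgrade L's bounded-LIPSCHITZ merging to merging on
all bounded continuous test functions (one-sided Prokhorov).  But the tightness this upgrade needs can be taken
on the `ℤ²` SIDE instead: the one-sided Prokhorov upgrade `SurfaceUniversality.tendsto_sub_of_isTightAlongMesh`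
only asks that ONE of two merging families be tight, and applied to the random curve classes
`Y_δ := CurveClass.map Ψ⁻¹ ∘ curve` under the critical `ℤ²` law of `D` (tight iff the `ℤ²` curve laws are —
continuous image) against `ν_δ :=` the jittered brick-wall law of `Ψ⁻¹D` pushed to curves, with the Lipschitz
merging of `Y_δ` and `ν_δ` supplied by A (tested against `g ∘ CurveClass.map Ψ⁻¹`) plus L, it yields the
`C_b`-merging the crux wants.  So the tightness leaf becomes

* (Z) `stub_eventualTight` = `SAWConfRestriction.EventualTight` (stmt-CriticalPhenomena-1881) BY NAME — eventual
  tightness (`IsTightAlongMesh`) of the critical `ℤ²` SAW laws pushed to curves, the item shared by ≥ 15 SAW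
  routes; and Z is PROVABLY NECESSARY for the crux: `z2Tight_of_modulusUniversality : ModulusUniversality → Z`
  (landed, `Theorems/SAWBrickWallHomotopyModulusUniversalityImpliesZ2Tight.lean`, p153735; see §3a).  Hence, kernel-checked in this file and in the tree:
  `crux ⇐ A ∧ Z ∧ L` and `crux ⇒ Z` — the tightness leaf now has zero slack.

RESHAPE 4 (lead c1, after waves 1–3).  The line's one NEW leaf, L (`JitteredLipMerging`, two-convention bounded-Lipschitz
merging; lead 0: `promote-stub`), has been driven into the tree down to two purely lattice estimates of different natures:
`L ⇐ JitteredEndpointCoupling` (p154967) `⇐ MiddleCoupling` (p158267, concatenation p157635) `⇐ MiddleTV` (p160048, maximal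
coupling) `⇐ (M2a) CollarNonHitting ∧ (M2b) BallInsensitivity` (p161425).  Reshape 4 registers M2a and M2b as the stubs in
place of L (L is DERIVED: `jitteredLipMerging_of_stubs`), so every open leaf of the skeleton is now either an existing item
(A = 5791 at t = 0, Z = 1881) or a sharply stated lattice estimate for the critical honeycomb two-point walk (M2a: boundary
non-hitting away from the marked points; M2b: endpoint / ball-environment insensitivity).  M2a ∧ M2b is stronger than L;
should either be refuted AS STATED, the fallback is to re-register L (its whole derivation chain stays in the tree).

RESHAPE 5 (lead c2, HONEST re-audit, 2026-08-17).  M2a mixed a deterministic geometric fact with the genuine open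
estimate.  The geometric fact is now PROVED (`stub_disputedCollar`, the COLLAR LEMMA: for every `η > 0`, eventually in
`δ`, every disputed site has its mesh point within `η` of `Eᶜ` — both bulk lemmas + the position-compatible dictionary),
and M2a is DERIVED (`collarNonHitting_of_stubs`) from two SINGLE-LAW, convention-free BOUNDARY-AVOIDANCE estimates —
(BA_bw) `stub_boundaryAvoidanceBW` for the straight brick-wall law with `ℤ²` conventions and (BA_hex)
`stub_boundaryAvoidanceHex` for the PLAIN honeycomb law `hexSAWLaw` in an arbitrary Dobrushin domain (a statement every
hexagonal SAW route can share) — plus the exact transport (BA_T) `stub_boundaryAvoidanceTransport` of (BA_hex) to the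
jittered law along `B` (provable now, like T).  Registered stubs after reshape 5: A, Z, M2b (open, as before), BA_bw, BA_hex (open,
clean); C = `stub_disputedCollar` (p165873) and BA_T = `stub_boundaryAvoidanceTransport` (p166091) were registered, PROVED
and LANDED by lead c2 and are imported here — five OPEN registered stubs remain, every one an open problem.

RESHAPE 6 (lead c2, same session).  (BA_hex) is NOT new debt for this route: it follows from the route's own crux
`HexConjecture` (item stmt-CriticalPhenomena-0808 = Duminil-Copin–Smirnov Conjecture 1, consumed by the Assembly anyway) by
portmanteau + Rohde–Schramm Thm 6.1 (SLE₈⸝₃ meets `∂D` only at the marked points — discharged in the tree), through the tree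
theorem `YbRelay.hex_noBoundaryCreep_of_hexSAWScalingLimit` (crux HexTransfer, stmt-14221).  Reshape 6 registers
H = `stub_hexConjecture` (= stmt-0808 BY NAME) in place of (BA_hex), with the provable glue stub
BA_H = `stub_boundaryAvoidanceHex_of_hexConjecture : HexConjecture → (BA_hex)` (LANDED by lead c2, p167392, imported).  OPEN registered stubs after
reshape 6: A (= 5791 @ t = 0), Z (= 1881), H (= 0808), BA_bw, M2b — three existing items of the ledger and two sharply stated lattice
estimates (BA_bw: boundary avoidance of the straight brick-wall law with `ℤ²` conventions; M2b: TV ball-insensitivity).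

State of the stubs before reshape 5 (four OPEN REGISTERED STUBS, each an open problem; two are existing ledger items):

* (A) `stub_brickWallComparison` — OPEN (universality-grade).  ∃ diagonal `Ψ`: the critical `ℤ²` SAW law in
  `D` merges with the `Ψ`-image of the critical STRAIGHT BRICK-WALL law `SAW.brickWallLaw (Ψ⁻¹D) δ 0` (ℤ²
  conventions).  DEFINITIONALLY the instance `t = 0` of the route crux `BrickWallFlow` (stmt-CriticalPhenomena-5791):
  `stub_brickWallComparison_of_brickWallFlow` (LANDED, p147368,
  `Theorems/SAWBrickWallHomotopyModulusUniversalityBrickWallFlowReduction.lean`, term `fun h => h 0 le_rfl one_pos`).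
* (Z) `stub_eventualTight` — OPEN = stmt-CriticalPhenomena-1881 BY NAME (see above); the `∃ δ₀`/`IsTightMeasureSet`
  twin is stmt-1372 (split into ConfinementPositivity + BulkShellTight by route SAWRenewalTightness).
* (M2a) `stub_collarNonHitting`, (M2b) `stub_ballInsensitivity` — OPEN, NEW (registered by reshape 4; statements in
  `__Registered` below; together they imply the former stub L by the landed chain).
* (L) `JitteredLipMerging` — DERIVED from M2a ∧ M2b (reshape 4); formerly the registered stub `stub_jitteredLipMerging`
  (kin `SAWCircleScreening.EndpointCoupling`, stmt-5465): bounded-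
  LIPSCHITZ merging of the straight (ℤ² conventions) with the jittered (honeycomb conventions, embedding
  `B ∘ hexCenter`, `B = diag(2, 2/√3)`) critical brick-wall laws for a jittered endpoint approximation of our
  choice = disputed-collar non-hitting + microscopic endpoint insensitivity of the critical honeycomb two-point
  law (no tightness content: on Lipschitz test functions the `≤ 2δ/3` jitter of the drawing costs `O(δ)`).
  Landed layers: `Theorems/…JitteredDrawing.lean` (p154956: position dictionary, drawing coupling),
  `Theorems/…LipOfEndpointCoupling.lean` (p154967: Lévy–Prokhorov ⇒ Lipschitz merging,
  `stub_jitteredLipMerging_of_endpointCoupling : JitteredEndpointCoupling → L`),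
  `Theorems/…Concatenation.lean` (p157635: `dist_mk_polyline_commonMiddle_le`, polylines sharing a middle block
  with `ρ`-small heads/tails are `2ρ`-close in `CurveClass`) and `Theorems/…LipOfMiddleCoupling.lean` (p158267:
  `tendsto_levyProkhorovDist_of_middleCoupling`, `stub_jitteredLipMerging_of_middleCoupling : MiddleCoupling → L`,
  MiddleCoupling = for every `ρ > 0`, eventually in `δ`, a COUPLING of the straight and jittered laws under which,
  off mass `≤ ρ`, the two abstract walks (read on brick-wall sites) share a middle block whose complements lie in
  the `ρ`-balls at the marked points — a purely lattice statement, no curve topology) and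
  `Theorems/…LipOfMiddleTV.lean` (p160048: `stub_jitteredLipMerging_of_middleTV : MiddleTV → L` via a maximal-coupling
  lemma `exists_coupling_of_forall_preimage_le`; MiddleTV = for every `ρ, ε > 0`, eventually in `δ`, for every set `A`
  of site lists, `P^{BW}(trim_ρ(support) ∈ A) ≤ P^{jBW}(trim_ρ(support read on sites) ∈ A) + ε`, `trim_ρ` = drop the
  maximal prefix inside `B(pt 0, ρ)` and the maximal suffix inside `B(pt 1, ρ)`).  Residual = MiddleTV = (M2a)
  disputed-collar non-hitting away from the marked points ∧ (M2b) ball-environment insensitivity of the trimmed walk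
  (Lean statements elaborated, lead c1 folder `work/stubs/MiddleTV-split.md`; crux workfiles `StubL-analysis.md`,
  `StubL_layers.lean`).
* (T) `stub_affineTransport` — LANDED (`Theorems/SAWBrickWallHomotopyModulusUniversalityAffineTransport.lean`,
  p150133): the jittered brick wall in `E` IS the hexagonal discretisation of `B⁻¹E` pushed forward by `B`.
* (H) `SAWDevelopingMap.HexTight` (stmt-5423) — NO LONGER A STUB; it remains an ALTERNATIVE sufficient tightness
  input (reshape-2 glue kept below as `jitteredTightAlongMesh_of_hexTight` + `conventionRobustness_of_jitteredTight`:
  H ∧ L ⇒ C, and A ∧ C ∧ T ⇒ crux as in reshape 2).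
* Φ = id edge LANDED: `modulusUniversality_of_latticeUniversality : SAWHexUniversality.LatticeUniversality →
  ModulusUniversality` (p154384).

Composition `ModulusUniversality_of : (A) → (Z) → (M2a) → (M2b) → ModulusUniversality` (kernel-checked, sorry-free;
(L) := `jitteredLipMerging_of_stubs (M2a) (M2b)` first):
`r = (2ρ₁, (2/√3)ρ₂)`, `Φ = Ψ ∘ B` (`Homeomorph.ext`); (A) at `(D,a,b)` gives `(a₁,b₁)` in `E = Ψ⁻¹D`; (L) at
`(E,a₁,b₁)` gives the jittered `(a',b')`; (T) transports `(a',b')` to a hexagonal endpoint approximation of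
`B⁻¹E = Φ⁻¹D` (`MarkedDomain.map_map`) and rewrites the jittered curve integrals EXACTLY as hexagonal ones composed
with `CurveClass.map B`; the one-sided Prokhorov upgrade with the tight family `CurveClass.map Ψ⁻¹ ∘ curve` under
the `ℤ²` law (Z) and `ν_δ` = jittered law pushed to curves turns [A on `g ∘ map Ψ⁻¹`] + [L on `g`] (bounded
Lipschitz `g`) into merging on every bounded continuous `F`; with `F = f ∘ CurveClass.map Ψ` and
`map Ψ (map Ψ⁻¹ c) = c`, `map (B.trans Ψ) = map Ψ ∘ map B` this is the crux.  No modulus value is asserted anywhere.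

Negatives honoured: no `Disproof.lean` exists for this crux (`ledger crux ls`, 2026-08-17); `ledger negatives`: the
only SAW-curve-law entry is the all-`δ` tightness stmt-0772 — (Z) is the EVENTUAL form (= 1881, not 0772); no stub
asserts a modulus VALUE (barrier `EmbeddingModulusUniqueness`) nor a local holomorphic observable on `ℤ²`
(barrier `NienhuisWeightsExcludeVertexSAW`).
-/

noncomputable section

open MeasureTheory Filter Topology
open scoped NNReal ENNReal
open Literature.Probability.LatticeModels
open Literature.Probability.RandomPlanarGeometry

namespace Summit.CriticalPhenomena.SAWScalingLimit.Cruxes.ModulusUniversality.Birth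

/-! ## 1. Vocabulary — TREE declarations only

`SAW.brickWallLaw Ω δ t a b` (`SAWBrickWall.lean`; at `t = 0`: weight `x_c(0)^{|γ|} 0^{N_odd(γ)}`,
`SAW.criticalFugacityT_zero : x_c(0) = 1/√(2+√2)` from Duminil-Copin–Smirnov Thm 1, proved in the tree),
`SAW.law`, `SAW.embLaw`, `SAW.hexSAWLaw`, `SAW.IsEndpointApprox`, `SAW.IsEmbEndpointApprox`, `hexGraph`,
`hexCenter`, `IsTightAlongMesh` (`SLEConvergenceCriterion.lean`), `MarkedDomain.map`, `CurveClass.map`,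
`SAWConfRestriction.EventualTight` (stmt-1881), `SAWDevelopingMap.HexTight` (stmt-5423).
No local definition of an OBJECT; the `def … : Prop` below are statement abbreviations of this workfile. -/

/-! ## 2. Statements of the line (workfile abbreviations) -/

/-- **(A) Brick-wall comparison modulo a diagonal modulus** (`BrickWallComparison`; the route's crux
`BrickWallFlow` at the endpoint `t = 0` of the weight homotopy, with `x_c(0)` evaluated to `1/√(2+√2)`):
there are `ρ₁, ρ₂ > 0` such that for the diagonal homeomorphism `Ψ = diag(ρ₁, ρ₂)`, every Dobrushin domain
`D` and every `ℤ²` endpoint approximation of `D`, some `ℤ²` endpoint approximation of `Ψ⁻¹(D)` carries an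
(eventually genuine) critical brick-wall law whose `Ψ`-image is asymptotically equal, on bounded continuous test
functions of the curve, to the critical `ℤ²` SAW law in `D`.  ONE graph (`δℤ² ∩ ·` with the tree's `ℤ²`
discretisation conventions on both sides), two `ℤ²`-periodic critical bond-weightings (`t = 1` uniform,
`t = 0` brick wall), one linear map; no value of `ρ₂/ρ₁` asserted. -/
def BrickWallComparison : Prop :=
  ∃ ρ₁ ρ₂ : ℝ, 0 < ρ₁ ∧ 0 < ρ₂ ∧ ∀ Ψ : ℂ ≃ₜ ℂ,
      (∀ z : ℂ, Ψ z = ((ρ₁ * z.re : ℝ) : ℂ) + ((ρ₂ * z.im : ℝ) : ℂ) * Complex.I) →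
      ∀ (D : DobrushinDomain) (a b : ℝ → Site 2), SAW.IsEndpointApprox D a b →
        ∃ a' b' : ℝ → Site 2, SAW.IsEndpointApprox (D.map Ψ.symm) a' b' ∧
          (∀ᶠ δ in nhdsWithin 0 (Set.Ioi 0),
            IsProbabilityMeasure (SAW.brickWallLaw (D.map Ψ.symm).carrier δ 0 (a' δ) (b' δ))) ∧
          ∀ f : BoundedContinuousFunction (CurveClass ℂ) ℝ,
            Tendsto (fun δ => (∫ γ, f γ.curve ∂(SAW.law D.carrier δ (a δ) (b δ))) -
              ∫ γ, f (CurveClass.map (Ψ : C(ℂ, ℂ)) γ.curve)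
                ∂(SAW.brickWallLaw (D.map Ψ.symm).carrier δ 0 (a' δ) (b' δ)))
              (nhdsWithin 0 (Set.Ioi 0)) (nhds 0)

/-- **(C) Convention robustness of the critical brick-wall law** (`ConventionRobustness`; reshape-1 stub,
expired, DERIVED from H ∧ L below and kept as the interface of the alternative H-glue): for the affinity
`B(x+iy) = 2x + i(2/√3)y`, every Dobrushin `E` and every `ℤ²` endpoint approximation `(a, b)` along which the
straight brick-wall law is eventually a probability measure there is a jittered endpoint approximation
`(a', b')` with `∫ f(curve) dP^{BW}_{E,δ}(a,b) − ∫ f(curve) dP^{jBW}_{E,δ}(a',b') → 0` for every bounded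
continuous `f`. -/
def ConventionRobustness : Prop :=
  ∀ B : ℂ ≃ₜ ℂ,
      (∀ z : ℂ, B z = ((2 * z.re : ℝ) : ℂ) + ((2 / Real.sqrt 3 * z.im : ℝ) : ℂ) * Complex.I) →
      ∀ (E : DobrushinDomain) (a b : ℝ → Site 2), SAW.IsEndpointApprox E a b →
        (∀ᶠ δ in nhdsWithin 0 (Set.Ioi 0),
          IsProbabilityMeasure (SAW.brickWallLaw E.carrier δ 0 (a δ) (b δ))) →
        ∃ a' b' : ℝ → HexVertex,
          SAW.IsEmbEndpointApprox hexGraph (fun v : HexVertex => B (hexCenter v)) E a' b' ∧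
          ∀ f : BoundedContinuousFunction (CurveClass ℂ) ℝ,
            Tendsto (fun δ => (∫ γ, f γ.curve ∂(SAW.brickWallLaw E.carrier δ 0 (a δ) (b δ))) -
              ∫ γ, f γ.curve ∂(SAW.embLaw hexGraph (fun v : HexVertex => B (hexCenter v)) E.carrier δ
                SAW.hexCriticalFugacity (a' δ) (b' δ)))
              (nhdsWithin 0 (Set.Ioi 0)) (nhds 0)

/-- **(T) Exact affine transport** (`AffineTransport`, LANDED as `stub_affineTransport`, p150133): `B` is
`ℝ`-linear, so the generic discretisation of `E` by the embedded graph `(hexGraph, B ∘ hexCenter)` IS the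
hexagonal discretisation of `B⁻¹(E)`, endpoint approximations correspond, and for all `δ` and all bounded
continuous `f`: `∫ f(curve) dP^{jBW}_{E,δ}(a',b') = ∫ f(B ∘ curve) dP^{Hex}_{B⁻¹E,δ}(a',b')` EXACTLY. -/
def AffineTransport : Prop :=
  ∀ B : ℂ ≃ₜ ℂ,
      (∀ z : ℂ, B z = ((2 * z.re : ℝ) : ℂ) + ((2 / Real.sqrt 3 * z.im : ℝ) : ℂ) * Complex.I) →
      ∀ (E : DobrushinDomain) (a' b' : ℝ → HexVertex),
        SAW.IsEmbEndpointApprox hexGraph (fun v : HexVertex => B (hexCenter v)) E a' b' →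
        SAW.IsEmbEndpointApprox hexGraph hexCenter (E.map B.symm) a' b' ∧
          ∀ (δ : ℝ) (f : BoundedContinuousFunction (CurveClass ℂ) ℝ),
            (∫ γ, f γ.curve ∂(SAW.embLaw hexGraph (fun v : HexVertex => B (hexCenter v)) E.carrier δ
                SAW.hexCriticalFugacity (a' δ) (b' δ))) =
              ∫ γ, f (CurveClass.map (B : C(ℂ, ℂ)) γ.curve)
                ∂(SAW.hexSAWLaw (E.map B.symm).carrier δ (a' δ) (b' δ))

/-- **(M1') eventual tightness of the jittered brick-wall law** (honeycomb conventions, embedding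
`B ∘ hexCenter`): for every jittered endpoint approximation the laws pushed to `CurveClass ℂ` are tight along
`δ → 0⁺`.  A consequence of `SAWDevelopingMap.HexTight` (stmt-5423) by the affine transport T
(`jitteredTightAlongMesh_of_hexTight`); interface of the alternative H-glue only. [folklore] -/
def JitteredTightAlongMesh : Prop :=
  ∀ B : ℂ ≃ₜ ℂ,
    (∀ z : ℂ, B z = ((2 * z.re : ℝ) : ℂ) + ((2 / Real.sqrt 3 * z.im : ℝ) : ℂ) * Complex.I) →
    ∀ (E : DobrushinDomain) (a' b' : ℝ → HexVertex),
      SAW.IsEmbEndpointApprox hexGraph (fun v : HexVertex => B (hexCenter v)) E a' b' →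
      IsTightAlongMesh
        (fun δ (γ : SAW.EmbDomainSAW hexGraph (fun v : HexVertex => B (hexCenter v)) E.carrier δ
          (a' δ) (b' δ)) => γ.curve)
        (fun δ => SAW.embLaw hexGraph (fun v : HexVertex => B (hexCenter v)) E.carrier δ
          SAW.hexCriticalFugacity (a' δ) (b' δ))

/-- **(L) bounded-Lipschitz merging of the straight and the jittered brick-wall laws** (`JitteredLipMerging`):
for the affinity `B = diag(2, 2/√3)`, every Dobrushin `E` and every `ℤ²` endpoint approximation along which the
straight brick-wall law (`ℤ²` conventions, `t = 0`) is eventually a probability measure, there is a jittered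
endpoint approximation (ours to choose) such that for every bounded LIPSCHITZ test function `g` on curve space
`∫ g(curve) dP^{BW}_{E,δ}(a,b) − ∫ g(curve) dP^{jBW}_{E,δ}(a',b') → 0`: the collar non-hitting + microscopic
endpoint insensitivity of the critical honeycomb two-point law (kin `SAWCircleScreening.EndpointCoupling`,
stmt-5465, one convention, `t = 1`).  No named fact of the tree delivers it. [folklore] -/
def JitteredLipMerging : Prop :=
  ∀ B : ℂ ≃ₜ ℂ,
    (∀ z : ℂ, B z = ((2 * z.re : ℝ) : ℂ) + ((2 / Real.sqrt 3 * z.im : ℝ) : ℂ) * Complex.I) →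
    ∀ (E : DobrushinDomain) (a b : ℝ → Site 2), SAW.IsEndpointApprox E a b →
      (∀ᶠ δ in nhdsWithin 0 (Set.Ioi 0),
        IsProbabilityMeasure (SAW.brickWallLaw E.carrier δ 0 (a δ) (b δ))) →
      ∃ a' b' : ℝ → HexVertex,
        SAW.IsEmbEndpointApprox hexGraph (fun v : HexVertex => B (hexCenter v)) E a' b' ∧
        ∀ (g : BoundedContinuousFunction (CurveClass ℂ) ℝ) (L : NNReal), LipschitzWith L g →
          Tendsto (fun δ => (∫ γ, g γ.curve ∂(SAW.brickWallLaw E.carrier δ 0 (a δ) (b δ))) -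
            ∫ γ, g γ.curve ∂(SAW.embLaw hexGraph (fun v : HexVertex => B (hexCenter v)) E.carrier δ
              SAW.hexCriticalFugacity (a' δ) (b' δ)))
            (nhdsWithin 0 (Set.Ioi 0)) (nhds 0)

/-! ### Name-keyed aliases of the registered stubs — the hypotheses of `ModulusUniversality_of`

The skeleton audit admits a hypothesis of the skeleton theorem only if its head constant is a registered
obligation or is NAMED like a declared stub; `__Registered.stub_X` is the statement of `stub_X` under that name.
Each alias is definitionally its statement. -/
namespace __Registered

/-- Alias of `BrickWallComparison` keyed by the registered stub name. -/
abbrev stub_brickWallComparison : Prop := BrickWallComparison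
/-- Alias of the item `SAWConfRestriction.EventualTight` (stmt-CriticalPhenomena-1881) keyed by the registered
stub name. -/
abbrev stub_eventualTight : Prop :=
  Summit.CriticalPhenomena.SAWScalingLimit.Theses.SAWConfRestriction.EventualTight
/-- **(M2a) disputed-collar non-hitting away from the marked points** (`stub_collarNonHitting`, registered stub of
reshape 4; since reshape 5 DERIVED — `collarNonHitting_of_stubs` — and kept under its old key as the interface of
`jitteredLipMerging_of_stubs`): under the straight law and under the jittered law, the probability that the walk visits a
DISPUTED site (one whose brick-wall adjacency differs between the `ℤ²` discrete domain restricted to brick-wall bonds,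
`discreteDomainGraph E δ ⊓ SAW.brickWallGraph`, and the jittered honeycomb discrete domain
`SAW.embDomainGraph hexGraph (B ∘ hexCenter) E δ` read through the position-compatible dictionary
`site (x,k) = (2x₀+x₁+k+1, x₁)`) at distance `≥ ρ` from BOTH marked points tends to `0` as `δ → 0⁺`.  Disputed sites
live in an `o(1)`-collar of `∂E` (bulk lemmas), so this is boundary non-hitting of the critical honeycomb two-point
walk away from its endpoints (SLE₈⸝₃ boundary exponent heuristics: room to spare); unproved on every lattice. -/
abbrev stub_collarNonHitting : Prop :=
  ∀ B : ℂ ≃ₜ ℂ, (∀ z : ℂ, B z = ((2 * z.re : ℝ) : ℂ) + ((2 / Real.sqrt 3 * z.im : ℝ) : ℂ) * Complex.I) → ∀ (E : DobrushinDomain) (a b : ℝ → Site 2) (a' b' : ℝ → HexVertex), SAW.IsEndpointApprox E a b → SAW.IsEmbEndpointApprox hexGraph (fun v => B (hexCenter v)) E a' b' → ∀ ρ : ℝ, 0 < ρ → Tendsto (fun δ => SAW.brickWallLaw E.carrier δ 0 (a δ) (b δ) {γ | ∃ x ∈ γ.walk.support, (∃ w w' : HexVertex, ![2 * w.1 0 +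 w.1 1 + ((w.2 : ℕ) : ℤ) + 1, w.1 1] = x ∧ ¬ ((discreteDomainGraph E.carrier δ ⊓ SAW.brickWallGraph).Adj x ![2 * w'.1 0 + w'.1 1 + ((w'.2 : ℕ) : ℤ) + 1, w'.1 1] ↔ (SAW.embDomainGraph hexGraph (fun v => B (hexCenter v)) E.carrier δ).Adj w w')) ∧ ∀ i, ρ ≤ dist (meshPoint δ x) (E.pt i)}) (nhdsWithin 0 (Set.Ioi 0)) (nhds 0) ∧ Tendsto (fun δ => SAW.embLaw hexGraph (fun v => B (hexCenter v)) E.carrier δ SAW.hexCriticalFugacity (a' δ) (b' δ) {γ | ∃ x ∈ γ.walk.support.map fun w : HexVertex => (![2 * w.1 0 + w.1 1 + ((w.2 : ℕ) : ℤ) + 1, w.1 1] : Site 2), (∃ w w' : HexVertex, ![2 * w.1 0 + w.1 1 + ((w.2 : ℕ) : ℤ) + 1, w.1 1] = x ∧ ¬ ((discreteDomainGraph E.carrier δ ⊓ SAW.brickWallGraph).Adj x ![2 * w'.1 0 + w'.1 1 + ((w'.2 : ℕ) : ℤ) + 1, w'.1 1] ↔ (SAW.embDomainGraph hexGraph (fun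 v => B (hexCenter v)) E.carrier δ).Adj w w')) ∧ ∀ i, ρ ≤ dist (meshPoint δ x) (E.pt i)}) (nhdsWithin 0 (Set.Ioi 0)) (nhds 0)

/-- **(M2b) ball-environment insensitivity of the trimmed walk** (`stub_ballInsensitivity`), keyed by the registered
stub name: CONDITIONED on visiting no far disputed site (so that both laws are critical SAW laws on two subgraphs of
the brick wall that coincide outside `B(pt 0, ρ) ∪ B(pt 1, ρ)`), the laws of the `ρ`-TRIMMED MIDDLE BLOCK of the walk
(drop the maximal prefix inside `B(pt 0, ρ)` and the maximal suffix inside `B(pt 1, ρ)`, read on brick-wall sites)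
under the two conventions merge in total variation: for every `ρ, ε > 0`, eventually in `δ`, for every set `A` of site
lists, `P^{BW}[trim ∈ A | no far disputed] ≤ P^{jBW}[trim ∈ A | no far disputed] + ε`.  Content: the walk after its
first exit from `B(pt 0, ρ)` forgets the `o(1)`-collar perturbation of `∂E` inside the balls and the microscopic
endpoint data (boundary quasi-multiplicativity / ratio mixing of the critical SAW; kin `SAWCircleScreening.EndpointCoupling`
stmt-5465 with inputs 5463/5464); unproved on every lattice.  Meaningful for THIS convention pair only (for arbitrary
graph pairs agreeing off the balls it fails: private in-ball corridors). -/
abbrev stub_ballInsensitivity : Prop :=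
  ∀ B : ℂ ≃ₜ ℂ, (∀ z : ℂ, B z = ((2 * z.re : ℝ) : ℂ) + ((2 / Real.sqrt 3 * z.im : ℝ) : ℂ) * Complex.I) → ∀ (E : DobrushinDomain) (a b : ℝ → Site 2) (a' b' : ℝ → HexVertex), SAW.IsEndpointApprox E a b → (∀ᶠ δ in nhdsWithin 0 (Set.Ioi 0), IsProbabilityMeasure (SAW.brickWallLaw E.carrier δ 0 (a δ) (b δ))) → SAW.IsEmbEndpointApprox hexGraph (fun v => B (hexCenter v)) E a' b' → ∀ ρ : ℝ, 0 < ρ → ∀ ε : ℝ, 0 < ε → ∀ᶠ δ in nhdsWithin 0 (Set.Ioi 0), ∀ A : Set (List (Site 2)), ProbabilityTheory.cond (SAW.brickWallLaw E.carrier δ 0 (a δ) (b δ)) {γ | ∀ x ∈ γ.walk.support, (∀ i, ρ ≤ dist (meshPoint δ x) (E.pt i)) → ¬ (∃ w w' : HexVertex, ![2 * w.1 0 + w.1 1 + ((w.2 : ℕ) : ℤ) + 1, w.1 1] = x ∧ ¬ ((discreteDomainGraph E.carrier δ ⊓ SAW.brickWallGraph).Adj x ![2 * w'.1 0 + w'.1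 1 + ((w'.2 : ℕ) : ℤ) + 1, w'.1 1] ↔ (SAW.embDomainGraph hexGraph (fun v => B (hexCenter v)) E.carrier δ).Adj w w'))} {γ | ((γ.walk.support.dropWhile fun x => decide (dist (meshPoint δ x) (E.pt 0) < ρ)).rdropWhile fun x => decide (dist (meshPoint δ x) (E.pt 1) < ρ)) ∈ A} ≤ ProbabilityTheory.cond (SAW.embLaw hexGraph (fun v => B (hexCenter v)) E.carrier δ SAW.hexCriticalFugacity (a' δ) (b' δ)) {γ | ∀ x ∈ γ.walk.support.map fun w : HexVertex => (![2 * w.1 0 + w.1 1 + ((w.2 : ℕ) : ℤ) + 1, w.1 1] : Site 2), (∀ i, ρ ≤ dist (meshPoint δ x) (E.pt i)) → ¬ (∃ w w' : HexVertex, ![2 * w.1 0 + w.1 1 + ((w.2 : ℕ) : ℤ) + 1, w.1 1] = x ∧ ¬ ((discreteDomainGraph E.carrier δ ⊓ SAW.brickWallGraph).Adj x ![2 * w'.1 0 + w'.1 1 + ((w'.2 : ℕ) : ℤ) + 1, w'.1 1] ↔ (SAW.embDomainGraph hexGraph (fun v => B (hexCenter v)) E.carrier δ).Adj w w'))} {γ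 | (((γ.walk.support.map fun w : HexVertex => (![2 * w.1 0 + w.1 1 + ((w.2 : ℕ) : ℤ) + 1, w.1 1] : Site 2)).dropWhile fun x => decide (dist (meshPoint δ x) (E.pt 0) < ρ)).rdropWhile fun x => decide (dist (meshPoint δ x) (E.pt 1) < ρ)) ∈ A} + ENNReal.ofReal ε

/-- **(C) the collar lemma** (`stub_disputedCollar`, reshape 5; PROVABLE, landed by lead c2), keyed by the registered stub
name: for every `η > 0`, eventually in `δ`, every disputed brick-wall site has its mesh point within `η` of `Eᶜ`. -/
abbrev stub_disputedCollar : Prop :=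
  ∀ B : ℂ ≃ₜ ℂ, (∀ z : ℂ, B z = ((2 * z.re : ℝ) : ℂ) + ((2 / Real.sqrt 3 * z.im : ℝ) : ℂ) * Complex.I) → ∀ (E : DobrushinDomain) (η : ℝ), 0 < η → ∀ᶠ δ in nhdsWithin 0 (Set.Ioi 0), ∀ x : Site 2, (∃ w w' : HexVertex, ![2 * w.1 0 + w.1 1 + ((w.2 : ℕ) : ℤ) + 1, w.1 1] = x ∧ ¬ ((discreteDomainGraph E.carrier δ ⊓ SAW.brickWallGraph).Adj x ![2 * w'.1 0 + w'.1 1 + ((w'.2 : ℕ) : ℤ) + 1, w'.1 1] ↔ (SAW.embDomainGraph hexGraph (fun v => B (hexCenter v)) E.carrier δ).Adj w w')) → Metric.infDist (meshPoint δ x) E.carrierᶜ < η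

/-- **(BA_bw) boundary avoidance of the straight critical brick-wall law** (`stub_boundaryAvoidanceBW`, reshape 5), keyed
by the registered stub name: for every Dobrushin `E`, every `ℤ²` endpoint approximation and every `ρ, ε > 0` there is a
collar width `η > 0` such that, eventually in `δ`, the straight brick-wall law (`ℤ²` conventions, `t = 0`) gives mass
`≤ ε` to the walks visiting a site within `η` of `Eᶜ` at distance `≥ ρ` from both marked points.  The critical two-point
honeycomb walk does not touch `∂E` away from its endpoints — open on every lattice (SLE₈⸝₃ boundary exponent heuristics). -/
abbrev stub_boundaryAvoidanceBW : Prop :=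
  ∀ (E : DobrushinDomain) (a b : ℝ → Site 2), SAW.IsEndpointApprox E a b → ∀ ρ : ℝ, 0 < ρ → ∀ ε : ℝ, 0 < ε → ∃ η : ℝ, 0 < η ∧ ∀ᶠ δ in nhdsWithin 0 (Set.Ioi 0), SAW.brickWallLaw E.carrier δ 0 (a δ) (b δ) {γ | ∃ x ∈ γ.walk.support, Metric.infDist (meshPoint δ x) E.carrierᶜ < η ∧ ∀ i, ρ ≤ dist (meshPoint δ x) (E.pt i)} ≤ ENNReal.ofReal ε

/-- **(BA_hex) boundary avoidance of the critical honeycomb law** (`stub_boundaryAvoidanceHex`, reshape 5), keyed by the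
registered stub name: the same estimate for the PLAIN hexagonal law `SAW.hexSAWLaw D δ (a δ) (b δ)` of an arbitrary
Dobrushin domain `D` with an arbitrary hexagonal endpoint approximation, positions `δ · hexCenter w`.  Convention-free and
route-independent (shareable with every hexagonal SAW route); open. -/
abbrev stub_boundaryAvoidanceHex : Prop :=
  ∀ (D : DobrushinDomain) (a b : ℝ → HexVertex), SAW.IsEmbEndpointApprox hexGraph hexCenter D a b → ∀ ρ : ℝ, 0 < ρ → ∀ ε : ℝ, 0 < ε → ∃ η : ℝ, 0 < η ∧ ∀ᶠ δ in nhdsWithin 0 (Set.Ioi 0), SAW.hexSAWLaw D.carrier δ (a δ) (b δ) {γ | ∃ w ∈ γ.walk.support, Metric.infDist ((δ : ℂ) * hexCenter w) D.carrierᶜ < η ∧ ∀ i, ρ ≤ dist ((δ : ℂ) * hexCenter w) (D.pt i)} ≤ ENNReal.ofReal ε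

/-- **(BA_T) transport of (BA_hex) to the jittered law** (`stub_boundaryAvoidanceTransport`, reshape 5; PROVABLE — exact
affine transport along `B` as in T, `‖z‖ ≤ ‖B z‖ ≤ 2‖z‖`, jitter `≤ 2δ/3`), keyed by the registered stub name. -/
abbrev stub_boundaryAvoidanceTransport : Prop :=
  (∀ (D : DobrushinDomain) (a b : ℝ → HexVertex), SAW.IsEmbEndpointApprox hexGraph hexCenter D a b → ∀ ρ : ℝ, 0 < ρ → ∀ ε : ℝ, 0 < ε → ∃ η : ℝ, 0 < η ∧ ∀ᶠ δ in nhdsWithin 0 (Set.Ioi 0), SAW.hexSAWLaw D.carrier δ (a δ) (b δ) {γ | ∃ w ∈ γ.walk.support, Metric.infDist ((δ : ℂ) * hexCenter w) D.carrierᶜ < η ∧ ∀ i, ρ ≤ dist ((δ : ℂ) * hexCenter w) (D.pt i)} ≤ ENNReal.ofReal ε) → ∀ B : ℂ ≃ₜ ℂ, (∀ z : ℂ, B z = ((2 * z.re : ℝ) : ℂ) + ((2 / Real.sqrt 3 * z.im : ℝ) : ℂ) * Complex.I) → ∀ (E : DobrushinDomain) (a' b' : ℝ → HexVertex), SAW.IsEmbEndpointApprox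 hexGraph (fun v => B (hexCenter v)) E a' b' → ∀ ρ : ℝ, 0 < ρ → ∀ ε : ℝ, 0 < ε → ∃ η : ℝ, 0 < η ∧ ∀ᶠ δ in nhdsWithin 0 (Set.Ioi 0), SAW.embLaw hexGraph (fun v => B (hexCenter v)) E.carrier δ SAW.hexCriticalFugacity (a' δ) (b' δ) {γ | ∃ x ∈ γ.walk.support.map fun w : HexVertex => (![2 * w.1 0 + w.1 1 + ((w.2 : ℕ) : ℤ) + 1, w.1 1] : Site 2), Metric.infDist (meshPoint δ x) E.carrierᶜ < η ∧ ∀ i, ρ ≤ dist (meshPoint δ x) (E.pt i)} ≤ ENNReal.ofReal ε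

/-- **(H) Duminil-Copin–Smirnov Conjecture 1** (`stub_hexConjecture`, reshape 6) = the route crux `HexConjecture`
(item stmt-CriticalPhenomena-0808) BY NAME, keyed by the registered stub name. -/
abbrev stub_hexConjecture : Prop :=
  Summit.CriticalPhenomena.SAWScalingLimit.Theses.SAWBrickWallHomotopy.HexConjecture

/-- **(BA_H) `HexConjecture ⇒ (BA_hex)`** (`stub_boundaryAvoidanceHex_of_hexConjecture`, reshape 6; PROVABLE — portmanteau +
Rohde–Schramm Thm 6.1 via `YbRelay.hex_noBoundaryCreep_of_hexSAWScalingLimit`; landed by lead c2), keyed by the registered stub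
name. -/
abbrev stub_boundaryAvoidanceHex_of_hexConjecture : Prop :=
  Summit.CriticalPhenomena.SAWScalingLimit.Theses.SAWBrickWallHomotopy.HexConjecture → ∀ (D : DobrushinDomain) (a b : ℝ → HexVertex), SAW.IsEmbEndpointApprox hexGraph hexCenter D a b → ∀ ρ : ℝ, 0 < ρ → ∀ ε : ℝ, 0 < ε → ∃ η : ℝ, 0 < η ∧ ∀ᶠ δ in nhdsWithin 0 (Set.Ioi 0), SAW.hexSAWLaw D.carrier δ (a δ) (b δ) {γ | ∃ w ∈ γ.walk.support, Metric.infDist ((δ : ℂ) * hexCenter w) D.carrierᶜ < η ∧ ∀ i, ρ ≤ dist ((δ : ℂ) * hexCenter w) (D.pt i)} ≤ ENNReal.ofReal ε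

/-- **(R) convention robustness of Duminil-Copin–Smirnov Conjecture 1, brick-wall form** (`stub_bwRobust`, reshape 7),
keyed by the registered stub name: GIVEN `HexConjecture` (DCS Conjecture 1 for the canonical honeycomb discretisation
`embMeshDomain hexGraph hexCenter`, all Dobrushin domains, all endpoint approximations), for the affinity
`B = diag(2, 2/√3)`, every Dobrushin `E` and every `ℤ²` endpoint approximation `(a, b)` of `E` along which the critical
straight brick-wall law `SAW.brickWallLaw E δ 0` (`ℤ²` conventions: largest `ℤ²` mesh component, closed-segment edge
rule, then brick-wall bonds only; weight `x_c(ℍ)^{#steps}`) is eventually a probability measure, the straightened curve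
classes `CurveClass.map B⁻¹ ∘ curve` converge in law to chordal SLE₈⸝₃ in `B⁻¹E` (`ConvergesInLawToSLE`).  The brick wall
IS the honeycomb lattice (`B ∘ hexCenter = site + O(δ)` vertical jitter, `hexGraph_adj_iff_brickWallGraph_adj`), so this is
DCS Conjecture 1 for a second, equally natural discretisation convention of the SAME critical model — the one a
`ℤ²`-native argument (the route's weight homotopy) produces. -/
abbrev stub_bwRobust : Prop :=
  Summit.CriticalPhenomena.SAWScalingLimit.Theses.SAWBrickWallHomotopy.HexConjecture → ∀ B : ℂ ≃ₜ ℂ, (∀ z : ℂ, B z = ((2 * z.re : ℝ) : ℂ) + ((2 / Real.sqrt 3 * z.im : ℝ) : ℂ) * Complex.I) → ∀ (E : DobrushinDomain) (a b : ℝ → Site 2), SAW.IsEndpointApprox E a b → (∀ᶠ δ in nhdsWithin 0 (Set.Ioi 0), IsProbabilityMeasure (SAW.brickWallLaw E.carrier δ 0 (a δ) (b δ))) → ConvergesInLawToSLE ((8 : NNReal) / 3) (E.map B.symm) (fun δ (γ : SAW.DomainSAW E.carrier δ (a δ) (b δ)) => CurveClass.map (B.symm : C(ℂ, ℂ)) γ.curve)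 (fun δ => SAW.brickWallLaw E.carrier δ 0 (a δ) (b δ))

end __Registered

/-! ## 3. Registered OPEN stubs (`sorry` lives only here; statements LITERAL / by item name) -/

/-- **STUB A (HARDEST; open, universality-grade) — `BrickWallComparison`, literal.**  Why plausibly true:
both weightings are critical `ℤ²`-periodic SAW models on the same graph, believed to have conformally
invariant scaling limits up to ONE linear map fixed by lattice symmetries (Beffara2008Universal §2;
LanglandsPouliotSaintaubin1994; FK analogue DKKMO2020Rotational Thm 1.9); it is what the route's ENGINE (cruxes
`BrickWallFlow`, `OddBondDensity`: fluctuation–response along `t ↦ x_c(t)^{|γ|} t^{N_odd}`) is built to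
deliver, and it never sees a second lattice or a second discretisation convention.  Why it might fail: as for
the crux — no integrable family contains the uniform `ℤ²` walk (barrier `NienhuisWeightsExcludeVertexSAW`);
tightness of the critical `ℤ²` walk is open; the period-2 weighting could leave a non-affine discrepancy (then
no diagonal `Ψ` exists).  Size: open problem (= stmt-5791 at `t = 0`, `stub_brickWallComparison_of_brickWallFlow`). -/
theorem stub_brickWallComparison :
    ∃ ρ₁ ρ₂ : ℝ, 0 < ρ₁ ∧ 0 < ρ₂ ∧ ∀ Ψ : ℂ ≃ₜ ℂ,
      (∀ z : ℂ, Ψ z = ((ρ₁ * z.re : ℝ) : ℂ) + ((ρ₂ * z.im : ℝ) : ℂ) * Complex.I) →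
      ∀ (D : DobrushinDomain) (a b : ℝ → Site 2), SAW.IsEndpointApprox D a b →
        ∃ a' b' : ℝ → Site 2, SAW.IsEndpointApprox (D.map Ψ.symm) a' b' ∧
          (∀ᶠ δ in nhdsWithin 0 (Set.Ioi 0),
            IsProbabilityMeasure (SAW.brickWallLaw (D.map Ψ.symm).carrier δ 0 (a' δ) (b' δ))) ∧
          ∀ f : BoundedContinuousFunction (CurveClass ℂ) ℝ,
            Tendsto (fun δ => (∫ γ, f γ.curve ∂(SAW.law D.carrier δ (a δ) (b δ))) -
              ∫ γ, f (CurveClass.map (Ψ : C(ℂ, ℂ)) γ.curve)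
                ∂(SAW.brickWallLaw (D.map Ψ.symm).carrier δ 0 (a' δ) (b' δ)))
              (nhdsWithin 0 (Set.Ioi 0)) (nhds 0) := by
  sorry

/-! **Former stub Z — `SAWConfRestriction.EventualTight` (stmt-CriticalPhenomena-1881): NO LONGER REGISTERED (reshape 7).**
It stays NECESSARY for the crux (§3a, `z2Tight_of_modulusUniversality`) but the reshape-7 composition does not consume it:
R is a genuine limit theorem for the straightened brick-wall curves, so no one-sided Prokhorov upgrade is needed.  Its alias
`__Registered.stub_eventualTight` is kept for §3a and for the reshape-3 glue `modulusUniversality_of_eventualTight` (tree). -/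

/-! **STUB C — `stub_disputedCollar` (the collar lemma): LANDED** (lead c2, p165873,
`Theorems/SAWBrickWallHomotopyModulusUniversalityDisputedCollar.lean`, imported; registered signature =
`__Registered.stub_disputedCollar`, checked below by an `example`). -/

example : __Registered.stub_disputedCollar := stub_disputedCollar

/-! **Former stubs BA_bw (`stub_boundaryAvoidanceBW`) and M2b (`stub_ballInsensitivity`): NO LONGER REGISTERED (reshape 7).**
They remain, with H, a SUFFICIENT lattice-level programme for R (BA_bw ∧ H ⇒ M2a by `collarNonHitting_of_stubs`; M2a ∧ M2b ⇒ L by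
`jitteredLipMerging_of_stubs`; L ∧ H ⇒ R: bounded-Lipschitz merging with a family converging to SLE₈⸝₃ — lead c3 helper file),
and BA_bw is a COROLLARY of R ∧ H (Portmanteau + Rohde–Schramm Thm 6.1, as `stub_boundaryAvoidanceHex_of_hexConjecture`).  Their
statements stay available as `__Registered.stub_boundaryAvoidanceBW` / `__Registered.stub_ballInsensitivity` (hypotheses of the
derived glue below; no `sorry`). -/

/-- **STUB H (open problem; = item stmt-CriticalPhenomena-0808 BY NAME) — `SAWBrickWallHomotopy.HexConjecture`.**
Duminil-Copin–Smirnov 2012 Conjecture 1: the critical honeycomb SAW converges to chordal SLE₈⸝₃ in every Dobrushin domain, for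
every hexagonal endpoint approximation.  Why here (reshape 7): it identifies the limit of the hexagonal side of the crux, and it
is ALREADY a crux of this route (rank 2), consumed by the Assembly — so it costs the route nothing beyond what it already owes.
Why it might fail / is open: the parafermionic observable satisfies only half of the discrete Cauchy–Riemann relations (barrier
`ParafermionicHalfCauchyRiemann`); no tightness input for the hexagonal SAW.  Size: open problem. -/
theorem stub_hexConjecture :
    Summit.CriticalPhenomena.SAWScalingLimit.Theses.SAWBrickWallHomotopy.HexConjecture := by
  sorry

/-- **STUB R (open, conjecture-grade; the line's ONE new leaf after reshape 7) — `stub_bwRobust`, literal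
(`__Registered.stub_bwRobust`).**  DCS Conjecture 1 for the `ℤ²`-CONVENTION discretisation of the honeycomb lattice, given DCS
Conjecture 1 for the canonical one: for `B = diag(2, 2/√3)`, every Dobrushin `E` and every `ℤ²` endpoint approximation along
which the critical straight brick-wall law (`t = 0`, weight `x_c(ℍ)^{#steps}` on brick-wall walks of the `ℤ²` discrete domain
of `E`) is eventually a probability law, `CurveClass.map B⁻¹ ∘ curve` converges in law to chordal SLE₈⸝₃ in `B⁻¹E`.
Why plausibly true: the brick wall is the honeycomb lattice (graph isomorphism, positions `B ∘ hexCenter = site + O(δ)`), the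
two discrete domains of `B⁻¹E` (canonical: hexagon centres in `B⁻¹E`, slanted closed-segment edges, largest component;
`ℤ²`-convention: pulled back from `δℤ² ∩ E`) differ only in an `o(1)`-collar of the boundary (collar lemma, p165873), and every
known mechanism for DCS Conjecture 1 (parafermionic observable + RSW-type input) is blind to such conventions; the macroscopic
curve should forget the `O(δ)` boundary layer and the microscopic endpoint data (SLE₈⸝₃ boundary non-hitting, restriction,
Kennedy–Lawler arXiv:1109.3091 §2: endpoint microstructure only multiplies partition functions).  Why it might fail / is open:
it is an endpoint-and-boundary-layer robustness of the critical two-point law WITHOUT a priori estimates — not derivable from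
`HexConjecture` by restriction/Portmanteau (the layer touches the endpoints; two-sided), the same wall as HexTransfer's
`stub_hexFaceRobust` (census `Cruxes/HexTransfer/Lines/yb-relay-hexFaceRobust-census.md`); adversarial `O(δ)`-moving domains CAN
change the limit (corridor example there), so the specific convention matters.  Size: conjecture-grade (= `HexConjecture` for a
second discretisation); lattice-level sufficient programme: the former leaves BA_bw ∧ M2b (with H). -/
theorem stub_bwRobust :
    Summit.CriticalPhenomena.SAWScalingLimit.Theses.SAWBrickWallHomotopy.HexConjecture → ∀ B : ℂ ≃ₜ ℂ, (∀ z : ℂ, B z = ((2 * z.re : ℝ) : ℂ) + ((2 / Real.sqrt 3 * z.im : ℝ) : ℂ) * Complex.I) → ∀ (E : DobrushinDomain) (a b : ℝ → Site 2), SAW.IsEndpointApprox E a b → (∀ᶠ δ in nhdsWithin 0 (Set.Ioi 0), IsProbabilityMeasure (SAW.brickWallLaw E.carrier δ 0 (a δ) (b δ))) → ConvergesInLawToSLE ((8 : NNReal) / 3) (E.map B.symm) (fun δ (γ : SAW.DomainSAW E.carrier δ (a δ) (b δ)) => CurveClass.map (B.symm : C(ℂ, ℂ)) γ.curve) (fun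 δ => SAW.brickWallLaw E.carrier δ 0 (a δ) (b δ)) := by
  sorry

/-! **STUB BA_H — `stub_boundaryAvoidanceHex_of_hexConjecture` (`HexConjecture ⇒ (BA_hex)`): LANDED** (lead c2, p167392,
`Theorems/SAWBrickWallHomotopyModulusUniversalityBoundaryAvoidanceHexOfHexConjecture.lean`, imported; registered signature =
`__Registered.stub_boundaryAvoidanceHex_of_hexConjecture`, checked below by an `example`). -/

example : __Registered.stub_boundaryAvoidanceHex_of_hexConjecture := stub_boundaryAvoidanceHex_of_hexConjecture

/-! **STUB BA_T — `stub_boundaryAvoidanceTransport`: LANDED** (lead c2, p166091,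
`Theorems/SAWBrickWallHomotopyModulusUniversalityBoundaryAvoidanceTransport.lean`, imported; registered signature =
`__Registered.stub_boundaryAvoidanceTransport`, checked below by an `example`). -/

example : __Registered.stub_boundaryAvoidanceTransport := stub_boundaryAvoidanceTransport

/-- **(BA_bw) ∧ (H) ⇒ (M2a)** — the former registered stub `stub_collarNonHitting` (reshape 4) DERIVED from the open
boundary-avoidance stub (BA_bw) and `HexConjecture` (through BA_H = `stub_boundaryAvoidanceHex_of_hexConjecture`, which gives
(BA_hex)) by the LANDED collar lemma and transport: `collarNonHitting_of_boundaryAvoidance`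
(p165873: by `stub_disputedCollar` the far disputed sites eventually lie in the `η`-collar, so the disputed-visit events
are contained in the collar-visit events) fed with `stub_boundaryAvoidanceTransport hH` (p166091) on the jittered
side. [folklore] -/
theorem collarNonHitting_of_stubs (hBW : __Registered.stub_boundaryAvoidanceBW)
    (hHex : __Registered.stub_hexConjecture) : __Registered.stub_collarNonHitting :=
  collarNonHitting_of_boundaryAvoidance hBW
    (stub_boundaryAvoidanceTransport (stub_boundaryAvoidanceHex_of_hexConjecture hHex))

/-- **(BA_bw) ∧ (H) ∧ (M2b) ⇒ (L)** through M2a — the reshape-6 lattice programme assembled (no `sorry`; hypotheses are the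
former registered stubs under their `__Registered` keys). [folklore] -/
theorem jitteredLipMerging_of_latticeStubs (hBW : __Registered.stub_boundaryAvoidanceBW)
    (hHex : __Registered.stub_hexConjecture) (h₂ : __Registered.stub_ballInsensitivity) : JitteredLipMerging :=
  stub_jitteredLipMerging_of_collarNonHitting_of_ballInsensitivity (collarNonHitting_of_stubs hBW hHex) h₂

/-- Statement-only record of the former stub M2b (`__Registered.stub_ballInsensitivity`), kept as an `example` binder so
that the literal signature continues to elaborate in this file (no `sorry`: it is a hypothesis). -/
example (h : __Registered.stub_ballInsensitivity) :
    ∀ B : ℂ ≃ₜ ℂ, (∀ z : ℂ, B z = ((2 * z.re : ℝ) : ℂ) + ((2 / Real.sqrt 3 * z.im : ℝ) : ℂ) * Complex.I) → ∀ (E : DobrushinDomain) (a b : ℝ → Site 2) (a' b' : ℝ → HexVertex), SAW.IsEndpointApprox E a b → (∀ᶠ δ in nhdsWithin 0 (Set.Ioi 0), IsProbabilityMeasure (SAW.brickWallLaw E.carrier δ 0 (a δ) (b δ))) → SAW.IsEmbEndpointApprox hexGraph (fun v => B (hexCenter v)) E a' b' → ∀ ρ : ℝ, 0 < ρ → ∀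 ε : ℝ, 0 < ε → ∀ᶠ δ in nhdsWithin 0 (Set.Ioi 0), ∀ A : Set (List (Site 2)), ProbabilityTheory.cond (SAW.brickWallLaw E.carrier δ 0 (a δ) (b δ)) {γ | ∀ x ∈ γ.walk.support, (∀ i, ρ ≤ dist (meshPoint δ x) (E.pt i)) → ¬ (∃ w w' : HexVertex, ![2 * w.1 0 + w.1 1 + ((w.2 : ℕ) : ℤ) + 1, w.1 1] = x ∧ ¬ ((discreteDomainGraph E.carrier δ ⊓ SAW.brickWallGraph).Adj x ![2 * w'.1 0 + w'.1 1 + ((w'.2 : ℕ) : ℤ) + 1, w'.1 1] ↔ (SAW.embDomainGraph hexGraph (fun v => B (hexCenter v)) E.carrier δ).Adj w w'))} {γ | ((γ.walk.support.dropWhile fun x => decide (dist (meshPoint δ x) (E.pt 0) < ρ)).rdropWhile fun x => decide (dist (meshPoint δ x) (E.pt 1) < ρ)) ∈ A} ≤ ProbabilityTheory.cond (SAW.embLaw hexGraph (fun v => B (hexCenter v)) E.carrier δ SAW.hexCriticalFugacity (a' δ) (b' δ)) {γ | ∀ x ∈ γ.walk.support.map fun w : HexVertex => (![2 * w.1 0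 + w.1 1 + ((w.2 : ℕ) : ℤ) + 1, w.1 1] : Site 2), (∀ i, ρ ≤ dist (meshPoint δ x) (E.pt i)) → ¬ (∃ w w' : HexVertex, ![2 * w.1 0 + w.1 1 + ((w.2 : ℕ) : ℤ) + 1, w.1 1] = x ∧ ¬ ((discreteDomainGraph E.carrier δ ⊓ SAW.brickWallGraph).Adj x ![2 * w'.1 0 + w'.1 1 + ((w'.2 : ℕ) : ℤ) + 1, w'.1 1] ↔ (SAW.embDomainGraph hexGraph (fun v => B (hexCenter v)) E.carrier δ).Adj w w'))} {γ | (((γ.walk.support.map fun w : HexVertex => (![2 * w.1 0 + w.1 1 + ((w.2 : ℕ) : ℤ) + 1, w.1 1] : Site 2)).dropWhile fun x => decide (dist (meshPoint δ x) (E.pt 0) < ρ)).rdropWhile fun x => decide (dist (meshPoint δ x) (E.pt 1) < ρ)) ∈ A} + ENNReal.ofReal ε :=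
  h

/-- **(M2a) ∧ (M2b) ⇒ (L)** — the former stub L (`JitteredLipMerging`, lead 0: `promote-stub`) DERIVED from the two
registered lattice stubs by the landed chain `M2a ∧ M2b → MiddleTV → MiddleCoupling → JitteredEndpointCoupling →
JitteredLPMerging → L` (`Theorems/…LipOfCollarSplit.lean` p161425, `…LipOfMiddleTV.lean` p160048,
`…LipOfMiddleCoupling.lean` p158267 + `…Concatenation.lean` p157635, `…LipOfEndpointCoupling.lean` p154967,
`…JitteredDrawing.lean` p154956). [folklore] -/
theorem jitteredLipMerging_of_stubs (h₁ : __Registered.stub_collarNonHitting)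
    (h₂ : __Registered.stub_ballInsensitivity) : JitteredLipMerging :=
  stub_jitteredLipMerging_of_collarNonHitting_of_ballInsensitivity h₁ h₂

/-! ## 3a. Necessity of stub Z (tree theorem)

`z2Tight_of_modulusUniversality : ModulusUniversality → ∀ D a b, SAW.IsEndpointApprox D a b → IsTightAlongMesh …`
(`Theorems/SAWBrickWallHomotopyModulusUniversalityImpliesZ2Tight.lean`, p153735) has as conclusion the statement of
`SAWConfRestriction.EventualTight` unfolded: `example : ModulusUniversality → __Registered.stub_eventualTight :=
z2Tight_of_modulusUniversality` elaborates (checked; not kept as a declaration so that no theorem of this workfile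
has an item other than the crux as its conclusion).  So the registered tightness leaf is NECESSARY as well as
sufficient. -/

example : Summit.CriticalPhenomena.SAWScalingLimit.Theses.SAWBrickWallHomotopy.ModulusUniversality →
    __Registered.stub_eventualTight :=
  z2Tight_of_modulusUniversality

/-! ## 3b. Proved glue — LANDED (`Theorems/SAWBrickWallHomotopyModulusUniversalityOfEventualTight.lean`, p156782)

`curveClass_map_symm_map`, `curveClass_map_map_symm`, `isTightAlongMesh_map`,
`eventually_isProbabilityMeasure_embLaw_of_merging`, the two-convention upgrade `tendsto_sub_jittered_of_tight`
(one-sided Prokhorov on `CurveClass.map Ψ⁻¹ ∘ curve` under the `ℤ²` law) and the registered sub-goal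
`modulusUniversality_of_eventualTight : (A) → (Z) → (L) → ModulusUniversality` are imported from the tree. -/

/-! ## 3b'. Registered PROVABLE glue stubs of reshape 7 — BOTH LANDED (lead c3 wave 1): R versus the former lattice leaves

**STUB W1 — `stub_bwRobust_of_jitteredLipMerging` : (L) ⇒ (R): LANDED** (p172453,
`Theorems/SAWBrickWallHomotopyModulusUniversalityBWRobustOfLipMerging.lean`, imported; with the reusable
`tendsto_integral_brickWall_of_lipMerging`).  Bounded-Lipschitz merging of the straight brick-wall law with the jittered law upgrades,
GIVEN `HexConjecture`, to convergence in law of the straightened brick-wall curves to SLE₈⸝₃ in `B⁻¹E` (affine transport makes the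
jittered curve integrals hexagonal ones; the hexagonal family converges; convergent upgrade from bounded-Lipschitz to bounded continuous
test functions `LatticeUniversality.Birth.tendsto_integral_sub_of_tendstoLaw`).  With `jitteredLipMerging_of_latticeStubs` the reshape-6
leaves BA_bw ∧ M2b (and H) are a sufficient programme for R (wiring `example` below).

**STUB W2 — `stub_boundaryAvoidanceBW_of_bwRobust` : (H) ∧ (R) ⇒ (BA_bw): LANDED** (p173155,
`Theorems/SAWBrickWallHomotopyModulusUniversalityBoundaryAvoidanceBWOfBWRobust.lean`, imported; lattice-free core
`noBoundaryCreep_of_convergesInLawToSLE` = Portmanteau + Rohde–Schramm Thm 6.1 for ANY 0-or-probability family converging to SLE₈⸝₃;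
helper file p173024 `…BrickWallGoodEndpointApprox.lean`: brick-wall-good `ℤ²` endpoint approximations exist for every Dobrushin domain,
`exists_isEndpointApprox_isProbabilityMeasure_brickWallLaw` — so R and A's eventual-probability clause are never vacuous).  Hence the
former leaf BA_bw is NECESSARY for R (given H) as well as part of a sufficient programme: the gap between R and the lattice programme
is exactly the excess strength of M2b (total-variation vs weak merging of the trimmed middle block).

Registered signatures, checked against the landed theorems by `example`s: -/

example :
    (∀ B : ℂ ≃ₜ ℂ, (∀ z : ℂ, B z = ((2 * z.re : ℝ) : ℂ) + ((2 / Real.sqrt 3 * z.im : ℝ) : ℂ) * Complex.I) → ∀ (E : DobrushinDomain) (a b : ℝ → Site 2), SAW.IsEndpointApprox E a b → (∀ᶠ δ in nhdsWithin 0 (Set.Ioi 0), IsProbabilityMeasure (SAW.brickWallLaw E.carrier δ 0 (a δ) (b δ))) → ∃ a' b' : ℝ → HexVertex, SAW.IsEmbEndpointApprox hexGraph (fun v : HexVertex => B (hexCenter v)) E a' b' ∧ ∀ (g : BoundedContinuousFunction (CurveClass ℂ) ℝ) (L : NNReal), LipschitzWith L g → Tendsto (fun δ => (∫ γ, g γ.curve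 ∂(SAW.brickWallLaw E.carrier δ 0 (a δ) (b δ))) - ∫ γ, g γ.curve ∂(SAW.embLaw hexGraph (fun v : HexVertex => B (hexCenter v)) E.carrier δ SAW.hexCriticalFugacity (a' δ) (b' δ))) (nhdsWithin 0 (Set.Ioi 0)) (nhds 0)) → Summit.CriticalPhenomena.SAWScalingLimit.Theses.SAWBrickWallHomotopy.HexConjecture → ∀ B : ℂ ≃ₜ ℂ, (∀ z : ℂ, B z = ((2 * z.re : ℝ) : ℂ) + ((2 / Real.sqrt 3 * z.im : ℝ) : ℂ) * Complex.I) → ∀ (E : DobrushinDomain) (a b : ℝ → Site 2), SAW.IsEndpointApprox E a b → (∀ᶠ δ in nhdsWithin 0 (Set.Ioi 0), IsProbabilityMeasure (SAW.brickWallLaw E.carrier δ 0 (a δ) (b δ))) → ConvergesInLawToSLE ((8 : NNReal) / 3) (E.map B.symm) (fun δ (γ : SAW.DomainSAW E.carrier δ (a δ) (b δ)) => CurveClass.map (B.symm : C(ℂ, ℂ)) γ.curve) (fun δ => SAW.brickWallLaw E.carrier δ 0 (a δ) (b δ)) :=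
  stub_bwRobust_of_jitteredLipMerging

example :
    Summit.CriticalPhenomena.SAWScalingLimit.Theses.SAWBrickWallHomotopy.HexConjecture → (Summit.CriticalPhenomena.SAWScalingLimit.Theses.SAWBrickWallHomotopy.HexConjecture → ∀ B : ℂ ≃ₜ ℂ, (∀ z : ℂ, B z = ((2 * z.re : ℝ) : ℂ) + ((2 / Real.sqrt 3 * z.im : ℝ) : ℂ) * Complex.I) → ∀ (E : DobrushinDomain) (a b : ℝ → Site 2), SAW.IsEndpointApprox E a b → (∀ᶠ δ in nhdsWithin 0 (Set.Ioi 0), IsProbabilityMeasure (SAW.brickWallLaw E.carrier δ 0 (a δ) (b δ))) → ConvergesInLawToSLE ((8 : NNReal) / 3) (E.map B.symm) (fun δ (γ : SAW.DomainSAW E.carrier δ (a δ) (b δ)) => CurveClass.map (B.symm : C(ℂ, ℂ)) γ.curve) (fun δ => SAW.brickWallLaw E.carrier δ 0 (a δ) (b δ))) → ∀ (E : DobrushinDomain) (a b : ℝ → Site 2), SAW.IsEndpointApprox E a b → ∀ ρ : ℝ, 0 < ρ → ∀ ε : ℝ, 0 < ε → ∃ η : ℝ, 0 < η ∧ ∀ᶠ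 δ in nhdsWithin 0 (Set.Ioi 0), SAW.brickWallLaw E.carrier δ 0 (a δ) (b δ) {γ | ∃ x ∈ γ.walk.support, Metric.infDist (meshPoint δ x) E.carrierᶜ < η ∧ ∀ i, ρ ≤ dist (meshPoint δ x) (E.pt i)} ≤ ENNReal.ofReal ε :=
  stub_boundaryAvoidanceBW_of_bwRobust

/-- Wiring of W1: the reshape-6 lattice leaves (BA_bw, H, M2b) imply R. -/
example (hBW : __Registered.stub_boundaryAvoidanceBW) (hHex : __Registered.stub_hexConjecture)
    (h₂ : __Registered.stub_ballInsensitivity) : __Registered.stub_bwRobust :=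
  stub_bwRobust_of_jitteredLipMerging (jitteredLipMerging_of_latticeStubs hBW hHex h₂)

/-- Wiring of W2: R (with H) implies the former leaf BA_bw. -/
example (hHex : __Registered.stub_hexConjecture) (hR : __Registered.stub_bwRobust) :
    __Registered.stub_boundaryAvoidanceBW :=
  stub_boundaryAvoidanceBW_of_bwRobust hHex hR

/-! ## 3c. Reshape-6 composition (kept, no `sorry`): the former five leaves still imply the crux

`modulusUniversality_of_eventualTight hA hZ (jitteredLipMerging_of_latticeStubs hBW hHex h₂)` — an `example`, so that
`ModulusUniversality_of` stays the only theorem of this file concluding the crux. -/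

example (hA : __Registered.stub_brickWallComparison) (hZ : __Registered.stub_eventualTight)
    (hHex : __Registered.stub_hexConjecture) (hBW : __Registered.stub_boundaryAvoidanceBW)
    (h₂ : __Registered.stub_ballInsensitivity) :
    Summit.CriticalPhenomena.SAWScalingLimit.Theses.SAWBrickWallHomotopy.ModulusUniversality :=
  modulusUniversality_of_eventualTight hA hZ (jitteredLipMerging_of_latticeStubs hBW hHex h₂)

/-! ## 4. The skeleton theorem: the registered stubs imply the crux, BY NAME (kernel-checked, no `sorry` here) -/

/-- **Two families converging in law to chordal SLE_κ in the same Dobrushin domain merge** on every bounded continuous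
test function: both limits are laws of SLE_κ random curves in `D`, which coincide (`IsSLECurve.map_eq_holds`, the tree's
unconditional uniqueness in law of chordal SLE; Lawler (2005) §6.1). [folklore] -/
theorem tendsto_sub_of_convergesInLawToSLE {κ : ℝ≥0} {D : DobrushinDomain}
    {Ω₁ : ℝ → Type*} [∀ δ, MeasurableSpace (Ω₁ δ)] {Ω₂ : ℝ → Type*} [∀ δ, MeasurableSpace (Ω₂ δ)]
    {X₁ : ∀ δ, Ω₁ δ → CurveClass ℂ} {P₁ : ∀ δ, Measure (Ω₁ δ)}
    {X₂ : ∀ δ, Ω₂ δ → CurveClass ℂ} {P₂ : ∀ δ, Measure (Ω₂ δ)}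
    (h₁ : ConvergesInLawToSLE κ D X₁ P₁) (h₂ : ConvergesInLawToSLE κ D X₂ P₂)
    (f : BoundedContinuousFunction (CurveClass ℂ) ℝ) :
    Tendsto (fun δ => (∫ ω, f (X₁ δ ω) ∂P₁ δ) - ∫ ω, f (X₂ δ ω) ∂P₂ δ) (nhdsWithin 0 (Set.Ioi 0)) (nhds 0) := by
  obtain ⟨Γ₁, hΓ₁, -, hT₁⟩ := h₁
  obtain ⟨Γ₂, hΓ₂, -, hT₂⟩ := h₂
  have hlaw : (Literature.Probability.Process.preWienerMeasure).map Γ₁ =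
      (Literature.Probability.Process.preWienerMeasure).map Γ₂ :=
    IsSLECurve.map_eq_holds hΓ₁ hΓ₂
  have hlim : (∫ ω, f (Γ₁ ω) ∂Literature.Probability.Process.preWienerMeasure) =
      ∫ ω, f (Γ₂ ω) ∂Literature.Probability.Process.preWienerMeasure := by
    rw [← integral_map hΓ₁.aemeasurable f.continuous.aestronglyMeasurable,
      ← integral_map hΓ₂.aemeasurable f.continuous.aestronglyMeasurable, hlaw]
  have h := (hT₁ f).sub (hT₂ f)
  rwa [hlim, sub_self] at h

/-- **`ModulusUniversality_of`: BrickWallComparison → HexConjecture → BWRobust → `ModulusUniversality`** (reshape 7).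
Glue: `r₁ = 2ρ₁`, `r₂ = (2/√3)ρ₂`, `Φ = diag(r₁, r₂) = Ψ ∘ B` with `Ψ = diag(ρ₁, ρ₂)`, `B = diag(2, 2/√3)`
(`QuadCrossing.stretchHomeomorph`; `Homeomorph.ext`); (A) at `(D,a,b)` gives `(a₁,b₁)` in `E = Ψ⁻¹D` with the straight
brick-wall law eventually a probability measure and the `ℤ²` law of `D` merging with its `Ψ`-image; a hexagonal endpoint
approximation `(a',b')` of `B⁻¹E = Φ⁻¹D` exists (`HexEndpointApprox.exists_isEmbEndpointApprox`, `MarkedDomain.map_map`);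
(H) there and (R) at `(E,a₁,b₁)` are two families converging in law to SLE₈⸝₃ in `B⁻¹E`, hence they merge
(`tendsto_sub_of_convergesInLawToSLE`, SLE uniqueness in law) — tested on `g = f ∘ CurveClass.map Φ`, for which
`g (B⁻¹∘curve) = f (Ψ∘curve)` (`CurveClass.map_homeomorph_trans`, `curveClass_map_map_symm`) and `g (curve) = f (Φ∘curve)`;
adding the two `o(1)`'s is the crux.  No modulus value is asserted anywhere. -/
theorem ModulusUniversality_of (hA : __Registered.stub_brickWallComparison)
    (hHex : __Registered.stub_hexConjecture) (hR : __Registered.stub_bwRobust) :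
    Summit.CriticalPhenomena.SAWScalingLimit.Theses.SAWBrickWallHomotopy.ModulusUniversality := by
  obtain ⟨ρ₁, ρ₂, hρ₁, hρ₂, hA⟩ := hA
  have h3 : 0 < Real.sqrt 3 := Real.sqrt_pos.2 (by norm_num)
  have h23 : (0 : ℝ) < 2 / Real.sqrt 3 := div_pos two_pos h3
  -- the affinity `B = diag(2, 2/√3)` (embedded honeycomb → brick wall) and the modulus map `Ψ = diag(ρ₁, ρ₂)`
  obtain ⟨B, hBz⟩ : ∃ B : ℂ ≃ₜ ℂ,
      ∀ z : ℂ, B z = ((2 * z.re : ℝ) : ℂ) + ((2 / Real.sqrt 3 * z.im : ℝ) : ℂ) * Complex.I :=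
    ⟨Literature.Probability.Percolation.QuadCrossing.stretchHomeomorph 2 (2 / Real.sqrt 3) two_pos h23,
      fun z => by
        rw [Literature.Probability.Percolation.QuadCrossing.stretchHomeomorph_apply, Complex.mk_eq_add_mul_I]⟩
  obtain ⟨Ψ, hΨz⟩ : ∃ Ψ : ℂ ≃ₜ ℂ,
      ∀ z : ℂ, Ψ z = ((ρ₁ * z.re : ℝ) : ℂ) + ((ρ₂ * z.im : ℝ) : ℂ) * Complex.I :=
    ⟨Literature.Probability.Percolation.QuadCrossing.stretchHomeomorph ρ₁ ρ₂ hρ₁ hρ₂, fun z => by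
      rw [Literature.Probability.Percolation.QuadCrossing.stretchHomeomorph_apply, Complex.mk_eq_add_mul_I]⟩
  refine ⟨2 * ρ₁, 2 / Real.sqrt 3 * ρ₂, mul_pos two_pos hρ₁, mul_pos h23 hρ₂, ?_⟩
  intro Φ hΦ D a b hab
  -- `Φ = Ψ ∘ B`
  have hΦeq : Φ = B.trans Ψ := by
    refine Homeomorph.ext fun z => ?_
    rw [Homeomorph.trans_apply, hΦ, hΨz, hBz]
    apply Complex.ext
    · simp only [Complex.add_re, Complex.add_im, Complex.mul_re, Complex.mul_im, Complex.ofReal_re,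
        Complex.ofReal_im, Complex.I_re, Complex.I_im]
      ring
    · simp only [Complex.add_re, Complex.add_im, Complex.mul_re, Complex.mul_im, Complex.ofReal_re,
        Complex.ofReal_im, Complex.I_re, Complex.I_im]
      ring
  subst hΦeq
  have hs : (B.trans Ψ).symm = Ψ.symm.trans B.symm := rfl
  rw [hs]
  -- (A): ℤ² law in `D` ≈ `Ψ`-image of the straight brick-wall law in `E = Ψ⁻¹ D`
  obtain ⟨a₁, b₁, hab₁, hprob, hT₁⟩ := hA Ψ hΨz D a b hab
  -- a hexagonal endpoint approximation of `B⁻¹E = Φ⁻¹D`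
  obtain ⟨a', b', hab'⟩ :=
    Summit.CriticalPhenomena.SAWScalingLimit.Theorems.HexEndpointApprox.exists_isEmbEndpointApprox
      (D.map (Ψ.symm.trans B.symm))
  -- (H) at `(B⁻¹E, a', b')` and (R) at `(E, a₁, b₁)`: two families converging in law to SLE(8/3) in `B⁻¹E`
  have hH := hHex (D.map (Ψ.symm.trans B.symm)) a' b' hab'
  have hBW := hR hHex B hBz (D.map Ψ.symm) a₁ b₁ hab₁ hprob
  rw [MarkedDomain.map_map] at hBW
  refine ⟨a', b', hab', fun f => ?_⟩
  -- test function `g = f ∘ CurveClass.map Φ`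
  set g : BoundedContinuousFunction (CurveClass ℂ) ℝ :=
    f.compContinuous ⟨CurveClass.map ((B.trans Ψ : ℂ ≃ₜ ℂ) : C(ℂ, ℂ)), CurveClass.continuous_map _⟩ with hg
  have key := tendsto_sub_of_convergesInLawToSLE hBW hH g
  have h1 : ∀ c : CurveClass ℂ,
      g (CurveClass.map (B.symm : C(ℂ, ℂ)) c) = f (CurveClass.map (Ψ : C(ℂ, ℂ)) c) := by
    intro c
    simp only [hg, BoundedContinuousFunction.compContinuous_apply, ContinuousMap.coe_mk,
      CurveClass.map_homeomorph_trans, Function.comp_apply, curveClass_map_map_symm]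
  have h2 : ∀ c : CurveClass ℂ, g c = f (CurveClass.map ((B.trans Ψ : ℂ ≃ₜ ℂ) : C(ℂ, ℂ)) c) := by
    intro c
    simp only [hg, BoundedContinuousFunction.compContinuous_apply, ContinuousMap.coe_mk]
  simp_rw [h1, h2] at key
  have hsum := (hT₁ f).add key
  rw [add_zero] at hsum
  refine hsum.congr fun δ => ?_
  ring

/-- Wiring check (an `example`, so that `ModulusUniversality_of` stays the only theorem concluding the crux):
the registered open stubs, with their literal types, feed the skeleton theorem — this term becomes the crux proof
when the three `sorry`s above are discharged. -/
example : Summit.CriticalPhenomena.SAWScalingLimit.Theses.SAWBrickWallHomotopy.ModulusUniversality :=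
  ModulusUniversality_of stub_brickWallComparison stub_hexConjecture stub_bwRobust

/-! ## 5. Alternative tightness input (reshape-2 glue, kept): H = `SAWDevelopingMap.HexTight` also suffices

`jitteredTightAlongMesh_of_hexTight : HexTight → JitteredTightAlongMesh` and
`conventionRobustness_of_jitteredTight : JitteredTightAlongMesh → JitteredLipMerging → ConventionRobustness`;
with (A), (C), (T) the reshape-2 composition gives the crux (not restated here, so that `ModulusUniversality_of`
stays the only theorem concluding it). -/

/-- The affinity `B = diag(2, 2/√3)` is real-homogeneous. [folklore] -/
theorem affinity_real_mul {B : ℂ ≃ₜ ℂ}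
    (hB : ∀ z : ℂ, B z = ((2 * z.re : ℝ) : ℂ) + ((2 / Real.sqrt 3 * z.im : ℝ) : ℂ) * Complex.I)
    (r : ℝ) (z : ℂ) : B ((r : ℂ) * z) = (r : ℂ) * B z := by
  simp only [hB]
  apply Complex.ext
  · simp only [Complex.add_re, Complex.mul_re, Complex.mul_im, Complex.ofReal_re,
      Complex.ofReal_im, Complex.I_re, Complex.I_im, Complex.add_im]
    ring
  · simp only [Complex.add_re, Complex.mul_re, Complex.mul_im, Complex.ofReal_re,
      Complex.ofReal_im, Complex.I_re, Complex.I_im, Complex.add_im]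
    ring

/-- The affinity `B = diag(2, 2/√3)` is affine on segments. [folklore] -/
theorem affinity_lineMap {B : ℂ ≃ₜ ℂ}
    (hB : ∀ z : ℂ, B z = ((2 * z.re : ℝ) : ℂ) + ((2 / Real.sqrt 3 * z.im : ℝ) : ℂ) * Complex.I)
    (x y : ℂ) (c : ℝ) : B (AffineMap.lineMap x y c) = AffineMap.lineMap (B x) (B y) c := by
  rw [AffineMap.lineMap_apply_module', AffineMap.lineMap_apply_module', Complex.real_smul,
    Complex.real_smul]
  simp only [hB]
  apply Complex.ext
  · simp only [Complex.add_re, Complex.add_im, Complex.sub_re, Complex.sub_im, Complex.mul_re,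
      Complex.mul_im, Complex.ofReal_re, Complex.ofReal_im, Complex.I_re, Complex.I_im]
    ring
  · simp only [Complex.add_re, Complex.add_im, Complex.sub_re, Complex.sub_im, Complex.mul_re,
      Complex.mul_im, Complex.ofReal_re, Complex.ofReal_im, Complex.I_re, Complex.I_im]
    ring

/-- **(H) ⇒ (M1').**  Hexagonal tightness in `B⁻¹E` (for the endpoint approximation transported by T) is
jittered tightness in `E`: the jittered law pushed to curves is the `CurveClass.map B`-image of the hexagonal
law pushed to curves (`map_curve_embLaw_affine`, T's file), and continuous images of compact sets are compact.
[folklore] -/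
theorem jitteredTightAlongMesh_of_hexTight
    (hH : Summit.CriticalPhenomena.SAWScalingLimit.Theses.SAWDevelopingMap.HexTight) :
    JitteredTightAlongMesh := by
  intro B hB E a' b' hab'
  have hBsmul := affinity_real_mul hB
  have hBline := affinity_lineMap hB
  obtain ⟨habH, -⟩ := stub_affineTransport B hB E a' b' hab'
  intro ε hε
  obtain ⟨K, hK, hev⟩ := hH (E.map B.symm) a' b' habH ε hε
  refine ⟨CurveClass.map (B : C(ℂ, ℂ)) '' K, hK.image (CurveClass.continuous_map _), ?_⟩
  filter_upwards [hev] with δ hδ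
  have hKm : MeasurableSet (CurveClass.map (B : C(ℂ, ℂ)) '' K)ᶜ :=
    (hK.image (CurveClass.continuous_map _)).isClosed.measurableSet.compl
  have hmap := map_curve_embLaw_affine hexGraph hexCenter B hBsmul hBline E.carrier δ
    SAW.hexCriticalFugacity (a' δ) (b' δ)
  calc SAW.embLaw hexGraph (fun v : HexVertex => B (hexCenter v)) E.carrier δ SAW.hexCriticalFugacity
          (a' δ) (b' δ) ((fun γ => γ.curve) ⁻¹' (CurveClass.map (B : C(ℂ, ℂ)) '' K)ᶜ)
        = ((SAW.embLaw hexGraph (fun v : HexVertex => B (hexCenter v)) E.carrier δ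
            SAW.hexCriticalFugacity (a' δ) (b' δ)).map (fun γ => γ.curve))
            (CurveClass.map (B : C(ℂ, ℂ)) '' K)ᶜ := by
          rw [Measure.map_apply (SAW.EmbDomainSAW.measurable_of_top _) hKm]
    _ = (((SAW.embLaw hexGraph hexCenter (B.symm '' E.carrier) δ SAW.hexCriticalFugacity
            (a' δ) (b' δ)).map (fun γ => γ.curve)).map (CurveClass.map (B : C(ℂ, ℂ))))
            (CurveClass.map (B : C(ℂ, ℂ)) '' K)ᶜ := by rw [hmap]
    _ = (SAW.embLaw hexGraph hexCenter (B.symm '' E.carrier) δ SAW.hexCriticalFugacity (a' δ) (b' δ))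
          ((fun γ => γ.curve) ⁻¹' ((CurveClass.map (B : C(ℂ, ℂ))) ⁻¹'
            (CurveClass.map (B : C(ℂ, ℂ)) '' K)ᶜ)) := by
          rw [Measure.map_apply (CurveClass.measurable_map _) hKm,
            Measure.map_apply (SAW.EmbDomainSAW.measurable_of_top _)
              ((CurveClass.measurable_map _) hKm)]
    _ ≤ (SAW.embLaw hexGraph hexCenter (B.symm '' E.carrier) δ SAW.hexCriticalFugacity (a' δ) (b' δ))
          ((fun γ => γ.curve) ⁻¹' Kᶜ) := by
          refine measure_mono (Set.preimage_mono ?_)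
          rw [Set.preimage_compl, Set.compl_subset_compl]
          exact Set.subset_preimage_image _ _
    _ ≤ ε := hδ

/-- **(M1') + (L) ⇒ (C).**  Tightness of the JITTERED law along the mesh and bounded-Lipschitz merging give
merging on ALL bounded continuous test functions: the one-sided Prokhorov upgrade
`SurfaceUniversality.tendsto_sub_of_isTightAlongMesh` applied with the roles of the two families exchanged and
the sign flipped (reshape-2 glue, kernel-checked). [folklore] -/
theorem conventionRobustness_of_jitteredTight (hT : JitteredTightAlongMesh)
    (hL : JitteredLipMerging) : ConventionRobustness := by
  intro B hB E a b hab hprob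
  obtain ⟨a', b', hab', hLip⟩ := hL B hB E a b hab hprob
  refine ⟨a', b', hab', fun f => ?_⟩
  set EL : (δ : ℝ) → Measure (SAW.EmbDomainSAW hexGraph (fun v : HexVertex => B (hexCenter v))
      E.carrier δ (a' δ) (b' δ)) := fun δ =>
    SAW.embLaw hexGraph (fun v : HexVertex => B (hexCenter v)) E.carrier δ
      SAW.hexCriticalFugacity (a' δ) (b' δ) with hEL
  set BW : (δ : ℝ) → Measure (SAW.DomainSAW E.carrier δ (a δ) (b δ)) := fun δ =>
    SAW.brickWallLaw E.carrier δ 0 (a δ) (b δ) with hBW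
  have h1 := hLip (BoundedContinuousFunction.const (CurveClass ℂ) (1 : ℝ)) 0
    (fun x y => by simp)
  have hνprob : ∀ᶠ δ in nhdsWithin 0 (Set.Ioi 0), IsProbabilityMeasure (EL δ) :=
    eventually_isProbabilityMeasure_embLaw_of_merging hprob (by simpa using h1)
  have hmap : ∀ (δ : ℝ) (g : BoundedContinuousFunction (CurveClass ℂ) ℝ),
      ∫ x, g x ∂((BW δ).map (fun γ => γ.curve)) = ∫ γ, g γ.curve ∂(BW δ) := fun δ g =>
    integral_map (SAW.DomainSAW.measurable_of_top _).aemeasurable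
      g.continuous.aestronglyMeasurable
  -- Lipschitz merging in the exchanged order
  have hLip' : ∀ (g : BoundedContinuousFunction (CurveClass ℂ) ℝ) (L : NNReal), LipschitzWith L g →
      Tendsto (fun δ => (∫ γ, g γ.curve ∂(EL δ)) - ∫ x, g x ∂((BW δ).map (fun γ => γ.curve)))
        (nhdsWithin 0 (Set.Ioi 0)) (nhds 0) := by
    intro g L hg
    have h := (hLip g L hg).neg
    rw [neg_zero] at h
    refine h.congr fun δ => ?_
    rw [hmap, neg_sub]
  have key := Summit.CriticalPhenomena.SAWScalingLimit.Theorems.SurfaceUniversality.tendsto_sub_of_isTightAlongMesh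
    (Ω := fun δ => SAW.EmbDomainSAW hexGraph (fun v : HexVertex => B (hexCenter v)) E.carrier δ
      (a' δ) (b' δ))
    (Y := fun δ (γ : SAW.EmbDomainSAW hexGraph (fun v : HexVertex => B (hexCenter v)) E.carrier δ
      (a' δ) (b' δ)) => γ.curve)
    (P := EL) (ν := fun δ => (BW δ).map (fun γ => γ.curve)) hνprob
    (Eventually.of_forall fun δ => (SAW.EmbDomainSAW.measurable_of_top _).aemeasurable)
    (hT B hB E a' b' hab')
    (by
      filter_upwards [hprob] with δ hδ
      exact Measure.isProbabilityMeasure_map (SAW.DomainSAW.measurable_of_top _).aemeasurable)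
    hLip' f
  have h := key.neg
  rw [neg_zero] at h
  refine h.congr fun δ => ?_
  rw [hmap, neg_sub]

end Summit.CriticalPhenomena.SAWScalingLimit.Cruxes.ModulusUniversality.Birth

end
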